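import Mathlib.LinearAlgebra.Dual.Lemmas
import Mathlib.LinearAlgebra.Basis.VectorSpace
import Literature.Combinatorics.Additive.LinearKneserBoundary
import HarnessLib

/-!
# Kneser's theorem for field extensions — duality (Bachoc–Serra–Zémor §2.2, Lemmas 8–13)

Topic `Literature/Combinatorics/Additive`; second proof file behind the named fact
`Literature.Combinatorics.Additive.LinearKneser`, following C. Bachoc, O. Serra, G. Zémor,
*Revisiting Kneser's theorem for field extensions*, Combinatorica 38 (2018) = arXiv:1510.01354
(BSZ), §2.2.

A nonzero `F`-linear functional `σ : L → F` on the field `L` gives the nondegenerate symmetric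
invariant form `⟨x, y⟩ = σ(xy)` (BSZ (2)); `perp σ U = {v : σ(uv) = 0 ∀ u ∈ U}` is the
orthogonal of a subspace and BSZ's dual of `X` is `X* = perp σ (X S)`.

BSZ let the duals `X*` (finite-COdimensional subspaces) be cells and apply submodularity to
mixed pairs. We avoid infinite-dimensional cells altogether: the only combinations that occur in
§3 are `X ∩ W* = dmeet σ S X W := X ⊓ perp σ (W S)` and `(X + W*)^* = dmeet σ S W X`, both
finite-dimensional, and the one inequality needed about them,

* `bdry_dmeet_add_bdry_dmeet_le` : `∂(X ◁ W) + ∂(W ◁ X) ≤ ∂X + ∂W` (`X ◁ W := dmeet σ S X W`),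

has a five-line finite-dimensional proof from the symmetry of the rank of the pairing between two
finite-dimensional subspaces (`finrank_add_finrank_inf_perp`, BSZ Lemma 8 = Bourbaki): this
single statement replaces BSZ Prop. 5 for mixed pairs together with Lemma 9 (iii) and
Lemma 11 (iii), (v). The other duality facts used in §3:

* `perp_perp` : `A^⊥⊥ = A` for finite-dimensional `A` (any `L`), BSZ's appeal to Bourbaki in
  Lemma 10 (ii); whence `stable_of_stable_perp` = BSZ Lemma 13 / Cor. 14 (an element stabilising
  `X*` stabilises the saturated `X`);
* `dmeet_ne_bot` = BSZ Lemma 12 in the form used with a dual cell, and `sup_mul_ne_top` = Lemma 12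
  for two finite-dimensional subspaces (no duality);
* when `L` itself is finite-dimensional: `finrank_add_finrank_perp` (`dim U + dim U^⊥ = dim L`)
  and `perp_mul_mem_cells` (the dual of a cell is a cell of the same boundary, BSZ Lemma 11),
  needed exactly once, to feed `sup_mul_ne_top` in BSZ Prop. 16/22.

## References
* [BachocSerraZemor2018Kneser] C. Bachoc, O. Serra, G. Zémor, Combinatorica 38 (2018) 759–777,
  §2.2 (Lemmas 8, 9, 10, 12, 13, Corollary 14), §2.3 (Lemma 11).
-/

noncomputable section

open Module Submodule
open scoped Pointwise

namespace Literature.Combinatorics.Additive.LinKneser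

variable {F L : Type*} [Field F] [Field L] [Algebra F L]

attribute [local instance] finiteDimensional_mul finiteDimensional_smul

/-! ### The form `⟨x, y⟩ = σ(xy)` and orthogonals -/

/-- The bilinear form `⟨x, y⟩_σ = σ(xy)` attached to a linear functional `σ : L → F`, as a
linear map `L → Dual L`. [cite: BachocSerraZemor2018Kneser, Section 2.2] -/
def form (σ : L →ₗ[F] F) : L →ₗ[F] L →ₗ[F] F := (LinearMap.mul F L).compr₂ σ

/-- `form σ x y = σ (x y)`. [cite: BachocSerraZemor2018Kneser, Section 2.2] -/
@[simp] theorem form_apply (σ : L →ₗ[F] F) (x y : L) : form σ x y = σ (x * y) := rfl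

/-- The form is symmetric. [cite: BachocSerraZemor2018Kneser, Section 2.2] -/
theorem form_comm (σ : L →ₗ[F] F) (x y : L) : form σ x y = form σ y x := by
  simp [mul_comm]

/-- The form of a nonzero functional is nondegenerate: `⟨x, ·⟩ = 0 ⇒ x = 0`.
[cite: BachocSerraZemor2018Kneser, Section 2.2] -/
theorem form_eq_zero_iff {σ : L →ₗ[F] F} (hσ : σ ≠ 0) {x : L} : form σ x = 0 ↔ x = 0 := by
  refine ⟨fun h => ?_, fun h => by simp [h]⟩
  by_contra hx
  apply hσ
  ext t
  have := LinearMap.congr_fun h (x⁻¹ * t)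
  simpa [mul_inv_cancel_left₀ hx] using this

/-- The orthogonal `U^⊥ = {v : σ(uv) = 0 for all u ∈ U}` of a subspace for the form `σ(xy)`.
[cite: BachocSerraZemor2018Kneser, Section 2.2] -/
def perp (σ : L →ₗ[F] F) (U : Submodule F L) : Submodule F L where
  carrier := {v | ∀ u ∈ U, σ (u * v) = 0}
  add_mem' {a b} ha hb u hu := by rw [mul_add, map_add, ha u hu, hb u hu, add_zero]
  zero_mem' u _ := by rw [mul_zero, map_zero]
  smul_mem' c {a} ha u hu := by rw [mul_smul_comm, map_smul, ha u hu, smul_zero]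

/-- Membership in the orthogonal. [cite: BachocSerraZemor2018Kneser, Section 2.2] -/
theorem mem_perp {σ : L →ₗ[F] F} {U : Submodule F L} {v : L} :
    v ∈ perp σ U ↔ ∀ u ∈ U, σ (u * v) = 0 :=
  Iff.rfl

/-- The orthogonal is antitone. [cite: BachocSerraZemor2018Kneser, Section 2.2] -/
theorem perp_anti (σ : L →ₗ[F] F) {U V : Submodule F L} (h : U ≤ V) : perp σ V ≤ perp σ U :=
  fun _ hv u hu => hv u (h hu)

/-- `U ≤ U^⊥⊥`. [cite: BachocSerraZemor2018Kneser, Section 2.2] -/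
theorem le_perp_perp (σ : L →ₗ[F] F) (U : Submodule F L) : U ≤ perp σ (perp σ U) :=
  fun u hu v hv => by rw [mul_comm]; exact hv u hu

/-- Nondegeneracy: `L^⊥ = 0` for `σ ≠ 0`. [cite: BachocSerraZemor2018Kneser, Section 2.2] -/
theorem perp_top {σ : L →ₗ[F] F} (hσ : σ ≠ 0) : perp σ ⊤ = ⊥ := by
  rw [eq_bot_iff]
  intro v hv
  rw [Submodule.mem_bot, ← form_eq_zero_iff hσ]
  ext t
  simpa [mul_comm] using hv t Submodule.mem_top

/-- Invariance `⟨xy, z⟩ = ⟨x, yz⟩` in the form we use it: `v ∈ (U W)^⊥ ↔ v W ≤ U^⊥`.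
[cite: BachocSerraZemor2018Kneser, Section 2.2, (2)] -/
theorem mem_perp_mul_iff {σ : L →ₗ[F] F} {U W : Submodule F L} {v : L} :
    v ∈ perp σ (U * W) ↔ ∀ w ∈ W, v * w ∈ perp σ U := by
  constructor
  · intro hv w hw u hu
    have := hv (u * w) (Submodule.mul_mem_mul hu hw)
    rwa [show u * w * v = u * (v * w) by ring] at this
  · intro h x hx
    refine Submodule.mul_induction_on hx (fun u hu w hw => ?_) (fun a b ha hb => ?_)
    · have := h w hw u hu
      rwa [show u * (v * w) = u * w * v by ring] at this
    · rw [add_mul, map_add, ha, hb, add_zero]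

/-! ### Rank symmetry (BSZ Lemma 8) and its consequences -/

/-- **Rank symmetry of the pairing** (BSZ Lemma 8, after Bourbaki): for finite-dimensional
subspaces `A, B`, `dim A - dim (A ∩ B^⊥) = dim B - dim (B ∩ A^⊥)` (both are the rank of the
pairing `A × B → F`), written additively. [cite: BachocSerraZemor2018Kneser, Lemma 8] -/
theorem finrank_add_finrank_inf_perp (σ : L →ₗ[F] F) (A B : Submodule F L)
    [FiniteDimensional F A] [FiniteDimensional F B] :
    finrank F A + finrank F ↥(B ⊓ perp σ A) = finrank F B + finrank F ↥(A ⊓ perp σ B) := by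
  -- the pairing `p : A → Dual B` and its flip `q : B → Dual A`
  let p : A →ₗ[F] Module.Dual F B := (form σ).domRestrict₁₂ A B
  let q : B →ₗ[F] Module.Dual F A := p.flip
  have hp : ∀ (a : A) (b : B), p a b = σ (a * b) := fun a b => rfl
  -- kernels
  have hkp : (LinearMap.ker p).map A.subtype = A ⊓ perp σ B := by
    ext x
    simp only [Submodule.mem_map, LinearMap.mem_ker, Submodule.mem_inf, mem_perp]
    constructor
    · rintro ⟨a, ha, rfl⟩
      refine ⟨a.2, fun u hu => ?_⟩
      have := LinearMap.congr_fun ha ⟨u, hu⟩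
      rw [hp] at this
      simpa [mul_comm] using this
    · rintro ⟨hxA, hx⟩
      refine ⟨⟨x, hxA⟩, ?_, rfl⟩
      ext b
      rw [hp]
      simpa [mul_comm] using hx b b.2
  have hkq : (LinearMap.ker q).map B.subtype = B ⊓ perp σ A := by
    ext x
    simp only [Submodule.mem_map, LinearMap.mem_ker, Submodule.mem_inf, mem_perp]
    constructor
    · rintro ⟨b, hb, rfl⟩
      refine ⟨b.2, fun u hu => ?_⟩
      have := LinearMap.congr_fun hb ⟨u, hu⟩
      simpa [q, hp] using this
    · rintro ⟨hxB, hx⟩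
      refine ⟨⟨x, hxB⟩, ?_, rfl⟩
      ext a
      simpa [q, hp] using hx a a.2
  -- ranges have the same dimension: `q = p.dualMap ∘ eval`
  have hq : q = p.dualMap ∘ₗ (Module.Dual.eval F B) := by
    ext b a
    rfl
  have hrange : finrank F (LinearMap.range q) = finrank F (LinearMap.range p) := by
    rw [hq, LinearMap.range_comp]
    have : LinearMap.range (Module.Dual.eval F B) = ⊤ :=
      LinearMap.range_eq_top.mpr (Module.evalEquiv F B).surjective
    rw [this, Submodule.map_top, LinearMap.finrank_range_dualMap_eq_finrank_range]
  have e1 := LinearMap.finrank_range_add_finrank_ker p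
  have e2 := LinearMap.finrank_range_add_finrank_ker q
  rw [← Submodule.finrank_map_subtype_eq A (LinearMap.ker p), hkp] at e1
  rw [← Submodule.finrank_map_subtype_eq B (LinearMap.ker q), hkq] at e2
  omega

/-- `A^⊥⊥ = A` for a finite-dimensional subspace `A` of `L` (any `L`), `σ ≠ 0`.
[cite: BachocSerraZemor2018Kneser, Lemma 10 (ii) (Bourbaki)] -/
theorem perp_perp {σ : L →ₗ[F] F} (hσ : σ ≠ 0) (A : Submodule F L) [FiniteDimensional F A] :
    perp σ (perp σ A) = A := by
  refine le_antisymm ?_ (le_perp_perp σ A)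
  intro z hz
  -- functionals `φ_i = ⟨b_i, ·⟩` for a basis `b` of `A`, and `⟨z, ·⟩`
  let b := Module.finBasis F A
  let φ : Fin (finrank F A) → L →ₗ[F] F := fun i => form σ ((b i : A) : L)
  have hv_perp : ∀ v : L, (∀ i, φ i v = 0) → v ∈ perp σ A := by
    intro v hv a ha
    have key : ∀ a' : A, σ ((a' : L) * v) = 0 := by
      intro a'
      have hrepr : (∑ i, b.repr a' i • b i) = a' := b.sum_repr a'
      have hcoe : ((a' : A) : L) = ∑ i, b.repr a' i • ((b i : A) : L) := by
        calc ((a' : A) : L) = ((∑ i, b.repr a' i • b i : A) : L) := by rw [hrepr]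
          _ = ∑ i, b.repr a' i • ((b i : A) : L) := by
            simp only [Submodule.coe_sum, Submodule.coe_smul]
      rw [hcoe, Finset.sum_mul, map_sum]
      refine Finset.sum_eq_zero fun i _ => ?_
      rw [smul_mul_assoc, map_smul]
      have : σ (((b i : A) : L) * v) = 0 := hv i
      rw [this, smul_zero]
    exact key ⟨a, ha⟩
  have hker : ⨅ i, LinearMap.ker (φ i) ≤ LinearMap.ker (form σ z) := by
    intro v hv
    rw [Submodule.mem_iInf] at hv
    have hvA : v ∈ perp σ A := hv_perp v fun i => hv i
    rw [LinearMap.mem_ker, form_apply, mul_comm]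
    exact hz v hvA
  obtain ⟨c, hc⟩ :=
    (Submodule.mem_span_range_iff_exists_fun F).mp (mem_span_of_iInf_ker_le_ker hker)
  -- `a₀ = ∑ c_i b_i ∈ A` has the same functional as `z`
  have ha₀A : (∑ i, c i • ((b i : A) : L)) ∈ A :=
    Submodule.sum_mem _ fun i _ => Submodule.smul_mem _ _ (b i).2
  have hzero : form σ (z - ∑ i, c i • ((b i : A) : L)) = 0 := by
    rw [map_sub, ← hc, map_sum, sub_eq_zero]
    refine Finset.sum_congr rfl fun i _ => ?_
    rw [map_smul]
  rw [form_eq_zero_iff hσ, sub_eq_zero] at hzero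
  rw [hzero]
  exact ha₀A

/-- In a finite-dimensional `L`: `dim U + dim U^⊥ = dim L` (`σ ≠ 0`).
[cite: BachocSerraZemor2018Kneser, Lemma 8] -/
theorem finrank_add_finrank_perp {σ : L →ₗ[F] F} (hσ : σ ≠ 0) [FiniteDimensional F L]
    (U : Submodule F L) : finrank F U + finrank F ↥(perp σ U) = finrank F L := by
  have h := finrank_add_finrank_inf_perp σ ⊤ U
  rw [perp_top hσ, finrank_top] at h
  have h1 : finrank F ↥(U ⊓ (⊥ : Submodule F L)) = 0 := by
    rw [inf_bot_eq, finrank_bot]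
  have h2 : finrank F ↥((⊤ : Submodule F L) ⊓ perp σ U) = finrank F ↥(perp σ U) := by
    rw [top_inf_eq]
  omega

/-- A nonzero `F`-linear functional on `L` exists. [folklore] -/
theorem exists_functional_ne_zero : ∃ σ : L →ₗ[F] F, σ ≠ 0 := by
  obtain ⟨f, hf, -⟩ := Submodule.exists_le_ker_of_notMem (p := (⊥ : Submodule F L))
    (v := (1 : L)) (by simp)
  exact ⟨f, fun h => hf (by simp [h])⟩

/-! ### The operation `X ◁ W = X ∩ (W S)^⊥` -/

/-- `dmeet σ S X W = X ∩ (W S)^⊥` — in BSZ's notation `X ∩ W*`, and also the dual `(W + X*)^*`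
of the sum of `W` with the dual cell `X*`; always finite-dimensional when `X` is.
[cite: BachocSerraZemor2018Kneser, Section 2.2–2.3] -/
def dmeet (σ : L →ₗ[F] F) (S X W : Submodule F L) : Submodule F L := X ⊓ perp σ (W * S)

/-- `X ◁ W ≤ X`. [cite: BachocSerraZemor2018Kneser, Section 2.3] -/
theorem dmeet_le (σ : L →ₗ[F] F) (S X W : Submodule F L) : dmeet σ S X W ≤ X := inf_le_left

/-- Unfolding `dmeet`. [cite: BachocSerraZemor2018Kneser, Section 2.3] -/
theorem dmeet_eq (σ : L →ₗ[F] F) (S X W : Submodule F L) : dmeet σ S X W = X ⊓ perp σ (W * S) :=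
  rfl

/-- Membership in `X ◁ W`. [cite: BachocSerraZemor2018Kneser, Section 2.3] -/
theorem mem_dmeet {σ : L →ₗ[F] F} {S X W : Submodule F L} {x : L} :
    x ∈ dmeet σ S X W ↔ x ∈ X ∧ x ∈ perp σ (W * S) :=
  Iff.rfl

/-- `X ◁ W` is finite-dimensional when `X` is. [folklore] -/
theorem finiteDimensional_dmeet (σ : L →ₗ[F] F) (S X W : Submodule F L) [FiniteDimensional F X] :
    FiniteDimensional F ↥(dmeet σ S X W) :=
  Submodule.finiteDimensional_of_le (dmeet_le σ S X W)

attribute [local instance] finiteDimensional_dmeet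

/-- `(X ◁ W) S ≤ X S ∩ W^⊥` (invariance of the form).
[cite: BachocSerraZemor2018Kneser, Lemma 9 (iii)] -/
theorem dmeet_mul_le (σ : L →ₗ[F] F) (S X W : Submodule F L) :
    dmeet σ S X W * S ≤ X * S ⊓ perp σ W := by
  rw [Submodule.mul_le]
  intro x hx s hs
  exact ⟨Submodule.mul_mem_mul hx.1 hs, (mem_perp_mul_iff.mp hx.2) s hs⟩

/-- An element of `X ◁ W` lies in `W^⊥` (take `s = 1`). [cite: BachocSerraZemor2018Kneser, Lemma 9] -/
theorem mem_perp_of_mem_dmeet {σ : L →ₗ[F] F} {S X W : Submodule F L} (h1 : (1 : L) ∈ S) {x : L}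
    (hx : x ∈ dmeet σ S X W) : x ∈ perp σ W := by
  simpa using (mem_perp_mul_iff.mp hx.2) 1 h1

/-- `X ◁ W` is saturated when `X` is. [cite: BachocSerraZemor2018Kneser, Lemma 10 (i), Lemma 11 (iv)] -/
theorem satur_dmeet (σ : L →ₗ[F] F) {S X : Submodule F L} (hX : satur S X = X) (W : Submodule F L) :
    satur S (dmeet σ S X W) = dmeet σ S X W := by
  refine le_antisymm (fun z hz => ⟨?_, ?_⟩) (le_satur _ _)
  · rw [← hX]
    exact fun s hs => (dmeet_mul_le σ S X W (hz s hs)).1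
  · exact mem_perp_mul_iff.mpr fun s hs => (dmeet_mul_le σ S X W (hz s hs)).2

/-- **Mixed submodularity** — the finite-dimensional replacement for BSZ Prop. 5 applied to the
pair `(X, W*)` together with Lemma 9 (iii) / Lemma 11 (iii): for finite-dimensional `X, W`,
`∂(X ◁ W) + ∂(W ◁ X) ≤ ∂X + ∂W`. Proof: `(X ◁ W)S ≤ XS ∩ W^⊥`, so the left side is at most
`[dim(XS ∩ W^⊥) - dim(W ∩ (XS)^⊥)] + [dim(WS ∩ X^⊥) - dim(X ∩ (WS)^⊥)] = [dim XS - dim W] +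
[dim WS - dim X]` by rank symmetry. [cite: BachocSerraZemor2018Kneser, Proposition 5 and Lemma 11 (iii)] -/
theorem bdry_dmeet_add_bdry_dmeet_le (σ : L →ₗ[F] F) {S : Submodule F L} (h1 : (1 : L) ∈ S)
    (X W : Submodule F L) [FiniteDimensional F X] [FiniteDimensional F W]
    [FiniteDimensional F S] :
    bdry S (dmeet σ S X W) + bdry S (dmeet σ S W X) ≤ bdry S X + bdry S W := by
  have e1 := bdry_add_finrank h1 (dmeet σ S X W)
  have e2 := bdry_add_finrank h1 (dmeet σ S W X)
  have e3 := bdry_add_finrank h1 X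
  have e4 := bdry_add_finrank h1 W
  have i1 : finrank F ↥(dmeet σ S X W * S) ≤ finrank F ↥(X * S ⊓ perp σ W) :=
    Submodule.finrank_mono (dmeet_mul_le σ S X W)
  have i2 : finrank F ↥(dmeet σ S W X * S) ≤ finrank F ↥(W * S ⊓ perp σ X) :=
    Submodule.finrank_mono (dmeet_mul_le σ S W X)
  have r1 := finrank_add_finrank_inf_perp σ (X * S) W
  have r2 := finrank_add_finrank_inf_perp σ (W * S) X
  have d1 : finrank F ↥(W ⊓ perp σ (X * S)) = finrank F ↥(dmeet σ S W X) := rfl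
  have d2 : finrank F ↥(X ⊓ perp σ (W * S)) = finrank F ↥(dmeet σ S X W) := rfl
  omega

/-- **BSZ Lemma 12** in the form used with a dual cell: if `dim XS ≤ dim X + dim S - 1`,
`X ◁ W ≠ 0` and `dim X ≤ dim W`, then `W ◁ X ≠ 0` (i.e. `(X + W*)^{**} ≠ L`).
[cite: BachocSerraZemor2018Kneser, Lemma 12] -/
theorem dmeet_ne_bot (σ : L →ₗ[F] F) {S : Submodule F L} {X W : Submodule F L}
    [FiniteDimensional F X] [FiniteDimensional F W] [FiniteDimensional F S]
    (hXS : finrank F ↥(X * S) + 1 ≤ finrank F X + finrank F S) (hne : dmeet σ S X W ≠ ⊥)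
    (hdim : finrank F X ≤ finrank F W) : dmeet σ S W X ≠ ⊥ := by
  obtain ⟨z, hz, hz0⟩ := Submodule.ne_bot_iff _ |>.mp hne
  have hzS : z • S ≤ X * S ⊓ perp σ W := (smul_le_mul hz S).trans (dmeet_mul_le σ S X W)
  have i1 : finrank F S ≤ finrank F ↥(X * S ⊓ perp σ W) := by
    rw [← finrank_smul hz0 S]
    exact Submodule.finrank_mono hzS
  have r1 := finrank_add_finrank_inf_perp σ (X * S) W
  have d1 : finrank F ↥(W ⊓ perp σ (X * S)) = finrank F ↥(dmeet σ S W X) := rfl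
  intro h
  have h0 : finrank F ↥(dmeet σ S W X) = 0 := by rw [h, finrank_bot]
  omega

/-- **BSZ Lemma 12** for two finite-dimensional subspaces (no duality): if
`dim XS ≤ dim X + dim S - 1`, `X ∩ Y ≠ 0`, and — when `L` is finite-dimensional —
`dim X + dim YS ≤ dim L`, then `(X + Y) S ≠ L`. [cite: BachocSerraZemor2018Kneser, Lemma 12] -/
theorem sup_mul_ne_top {S : Submodule F L} {X Y : Submodule F L}
    [FiniteDimensional F X] [FiniteDimensional F Y] [FiniteDimensional F S]
    (hXS : finrank F ↥(X * S) + 1 ≤ finrank F X + finrank F S) (hne : X ⊓ Y ≠ ⊥)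
    (hL : FiniteDimensional F L → finrank F X + finrank F ↥(Y * S) ≤ finrank F L) :
    (X ⊔ Y) * S ≠ ⊤ := by
  intro htop
  have hfdL : FiniteDimensional F L := by
    have : FiniteDimensional F ↥((X ⊔ Y) * S) := inferInstance
    rw [htop] at this
    exact Module.Finite.equiv (Submodule.topEquiv : (⊤ : Submodule F L) ≃ₗ[F] L)
  have hn : finrank F ↥((X ⊔ Y) * S) = finrank F L := by rw [htop, finrank_top]
  obtain ⟨z, hz, hz0⟩ := Submodule.ne_bot_iff _ |>.mp hne
  have hzS : z • S ≤ X * S ⊓ Y * S :=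
    le_inf (smul_le_mul hz.1 S) (smul_le_mul hz.2 S)
  have i1 : finrank F S ≤ finrank F ↥(X * S ⊓ Y * S) := by
    rw [← finrank_smul hz0 S]
    exact Submodule.finrank_mono hzS
  have m := Submodule.finrank_sup_add_finrank_inf_eq (X * S) (Y * S)
  rw [← Submodule.sup_mul] at m
  have := hL hfdL
  omega

/-- **BSZ Lemma 13 / Corollary 14**: an element stabilising the dual `X* = (XS)^⊥` of a
finite-dimensional saturated `X` stabilises `X`. [cite: BachocSerraZemor2018Kneser, Lemma 13] -/
theorem stable_of_stable_perp {σ : L →ₗ[F] F} (hσ : σ ≠ 0) {S X : Submodule F L}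
    [FiniteDimensional F X] [FiniteDimensional F S] (hX : satur S X = X) {k : L}
    (hk : ∀ y ∈ perp σ (X * S), k * y ∈ perp σ (X * S)) : ∀ x ∈ X, k * x ∈ X := by
  intro x hx
  rw [← hX, mem_satur]
  intro s hs
  rw [← perp_perp hσ (X * S)]
  intro y hy
  have := hk y hy (x * s) (Submodule.mul_mem_mul hx hs)
  rwa [show y * (k * x * s) = x * s * (k * y) by ring]

/-- In a finite-dimensional `L`, the dual `Y* = (YS)^⊥` of a cell `Y` of positive boundary is a
cell with the same boundary and `dim Y* = dim L - dim YS` (BSZ Lemma 11 (i)–(iii) for duals;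
used only to bound the dimension of kernels by `dim L - dim YS`).
[cite: BachocSerraZemor2018Kneser, Lemma 11] -/
theorem perp_mul_mem_cells {σ : L →ₗ[F] F} (hσ : σ ≠ 0) {S : Submodule F L} (h1 : (1 : L) ∈ S)
    [FiniteDimensional F L] {Y : Submodule F L} (hY : Y ∈ cells S) (hb : 0 < bdry S Y) :
    perp σ (Y * S) ∈ cells S ∧ bdry S (perp σ (Y * S)) = bdry S Y ∧
      finrank F ↥(perp σ (Y * S)) + finrank F ↥(Y * S) = finrank F L := by
  obtain ⟨hfd, hsat, hbot, -⟩ := hY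
  have hsat' : satur S (perp σ (Y * S)) = perp σ (Y * S) := by
    have h := satur_dmeet σ (satur_top S) Y
    rwa [dmeet_eq, top_inf_eq] at h
  have hperp2 : perp σ (perp σ (Y * S) * S) = Y := by
    ext v
    rw [mem_perp_mul_iff, perp_perp hσ (Y * S), ← hsat, mem_satur, hsat]
  have d1 := finrank_add_finrank_perp hσ (Y * S)
  have d2 := finrank_add_finrank_perp hσ (perp σ (Y * S) * S)
  rw [hperp2] at d2
  have e1 := bdry_add_finrank h1 (perp σ (Y * S))
  have e2 := bdry_add_finrank h1 Y
  have hb' : bdry S (perp σ (Y * S)) = bdry S Y := by omega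
  refine ⟨⟨inferInstance, hsat', ?_, ?_⟩, hb', by omega⟩
  · intro h
    rw [h, bdry_bot] at hb'
    omega
  · intro h
    have hY0 : finrank F ↥(Y * S) = 0 := by
      have : finrank F ↥(perp σ (Y * S)) = finrank F L := by rw [h, finrank_top]
      omega
    rw [Submodule.finrank_eq_zero] at hY0
    exact hbot (le_bot_iff.mp (hY0 ▸ le_mul_of_one_mem h1 Y))

end Literature.Combinatorics.Additive.LinKneser
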